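import Summits.ResolutionOfSingularities.ResolutionOfSingularities.Theorems.MarkedTransferCampaignW46FiniteExitBoundCentreGeometry
import Literature.AlgebraicGeometry.Resolution.BlowupPointDeltaDrop
import Literature.AlgebraicGeometry.Resolution.QuadraticTransforms
import HarnessLib

/-!
# [OURS · L1 W4.6 rung (i-a)′] The local rings over the blown-up point are QUADRATIC TRANSFORMS of `𝒪_{Z,ξ}` inside
# the function field (cell res-hironaka, LADDER-RESOLUTION rung L, D-0089; campaign s46, seat res-D-pv-046 AS
# res-L1-s46-pv-9 — SCHEME→RLR DICTIONARY of the centre clause, part 2; host route MarkedTransfer,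
# `--supports stmt-ResolutionOfSingularities-16156 --as helper`)

HONEST FRAMING. Nothing here is a statement of H. Hironaka's manuscript (2017-03-23, [Hironaka2017]) and nothing here
asserts that any statement of it holds. Pure scheme / commutative algebra over TREE theorems: the chart presentation of the
stalks of a blowing up (`BlowupStalkCharts.lean`, Stacks 0804/0805), the canonical embeddings `ε_{ξ′} : 𝒪_{Z′,ξ′} → K(Z)`
(`BlowupStalkEmbedding.lean`, `BlowupPointDeltaDrop.lean` §Fibre; Kollár 2007 §1.4) and Cutkosky's/Abhyankar's quadratic
transforms (`QuadraticTransforms.lean`). It is a port of `ProjModel.isQuadraticTransform_of_chart`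
(`TowerQuadraticTransform.lean`, projective models) to an arbitrary integral locally Noetherian base `Z` and the function
field `K(Z)`. AI review is weaker than expert review. No `sorry`; axioms standard.

## What this file provides (for res-L1-s46-pv-8's marked quadratic tree, HOME/STATUS 2026-08-27T05:03:39Z)

For a blowing up `π : Z′ → Z` (`IsBlowup π J`) of an integral locally Noetherian scheme `Z` with `Z′` integral, a point
`ξ′` of `Z′` over `ξ = π ξ′` with `J_ξ = 𝔪_ξ` (the blowing up of the closed point `ξ`, near `ξ`):

* `(𝒪_{Z,ξ} → K(Z)).range` (`exists_stalk_equiv_range`: `≅ 𝒪_{Z,ξ}`) and `(hπ.fibreSubalgebra ξ ξ′ h).toSubring =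
  ε_{ξ′}(𝒪_{Z′,ξ′})` are the two local rings READ IN `K(Z)`; `isLocalRingOf_range_algebraMap_stalk` (`𝒪_{Z,ξ}` is a local ring OF `K(Z)`: local, and
  every element of `K(Z)` is a fraction), `range_algebraMap_stalk_le_fibreSubalgebra`, `subringDominates_fibreSubalgebra`
  (`ε_{ξ′}(𝒪_{Z′,ξ′})` dominates `𝒪_{Z,ξ}`: the stalk map is local);
* **`isQuadraticTransform_fibreSubalgebra`** — `ε_{ξ′}(𝒪_{Z′,ξ′})` is a QUADRATIC TRANSFORM of `𝒪_{Z,ξ}` in the sense of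
  `IsQuadraticTransform` (Cutkosky 2014 §2.1 / Abhyankar 1956): it contains `𝒪_{Z,ξ}[𝔪_ξ/c_j]` for the chart parameter
  `c_j` through `ξ′`, consists of fractions of it with unit denominators, and dominates `𝒪_{Z,ξ}`.

## References

* The Stacks Project, Tags 0804, 0805, 01J7. [StacksProject]
* S. D. Cutkosky, Math. Ann. 362 (2015), §2.1 (quadratic transforms). [Cutkosky2014]
* J. Kollár, *Lectures on Resolution of Singularities* (2007), §1.4. [Kollar2007]
-/

noncomputable section

set_option linter.dupNamespace false -- mandated namespace of this single-conjunct summit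

open CategoryTheory AlgebraicGeometry TopologicalSpace IsLocalRing

namespace Summit.ResolutionOfSingularities.ResolutionOfSingularities.Theorems

namespace CampaignW46

open Literature.AlgebraicGeometry.Resolution
open Scheme.IdealSheafData

universe u

section FibreDictionary

variable {Z Z' : Scheme.{u}} [IsIntegral Z] {π : Z' ⟶ Z} {J : Z.IdealSheafData}

/-! ## The local ring of the base read in the function field -/

/-- `𝒪_{Z,ξ} → K(Z)` is injective (`Z` integral). [folklore] -/
theorem algebraMap_stalk_functionField_injective (ξ : Z) :
    Function.Injective (algebraMap (Z.presheaf.stalk ξ) Z.functionField) :=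
  IsFractionRing.injective (Z.presheaf.stalk ξ) Z.functionField

/-- The image of `𝒪_{Z,ξ}` in `K(Z)` is a local ring. [folklore] -/
theorem isLocalRing_range_algebraMap_stalk (ξ : Z) :
    IsLocalRing (algebraMap (Z.presheaf.stalk ξ) Z.functionField).range :=
  IsLocalRing.of_surjective' (algebraMap (Z.presheaf.stalk ξ) Z.functionField).rangeRestrict
    (algebraMap (Z.presheaf.stalk ξ) Z.functionField).rangeRestrict_surjective

/-- **`𝒪_{Z,ξ}` is a local ring OF `K(Z)`** (`IsLocalRingOf`: local, and `K(Z)` is its field of fractions). [folklore] -/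
theorem isLocalRingOf_range_algebraMap_stalk (ξ : Z) :
    IsLocalRingOf (algebraMap (Z.presheaf.stalk ξ) Z.functionField).range := by
  refine ⟨isLocalRing_range_algebraMap_stalk ξ, fun z => ?_⟩
  obtain ⟨a, b, hb, hab⟩ := IsFractionRing.div_surjective (A := Z.presheaf.stalk ξ) z
  refine ⟨algebraMap _ _ a, ⟨a, rfl⟩, algebraMap _ _ b, ⟨b, rfl⟩, ?_, hab.symm⟩
  exact (map_ne_zero_iff _ (algebraMap_stalk_functionField_injective ξ)).mpr (nonZeroDivisors.ne_zero hb)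

/-- `𝒪_{Z,ξ}` is isomorphic to its image in `K(Z)`, compatibly with the inclusion, and the isomorphism matches the
maximal ideals (stated as an existence, to keep this file definition-free). [folklore] -/
theorem exists_stalk_equiv_range (ξ : Z) :
    ∃ e : Z.presheaf.stalk ξ ≃+* (algebraMap (Z.presheaf.stalk ξ) Z.functionField).range,
      (∀ a, ((e a : (algebraMap (Z.presheaf.stalk ξ) Z.functionField).range) : Z.functionField) =
        algebraMap (Z.presheaf.stalk ξ) Z.functionField a) ∧
      ∀ a, haveI := isLocalRing_range_algebraMap_stalk (Z := Z) ξ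
        (a ∈ maximalIdeal (Z.presheaf.stalk ξ) ↔
          e a ∈ maximalIdeal (algebraMap (Z.presheaf.stalk ξ) Z.functionField).range) := by
  haveI := isLocalRing_range_algebraMap_stalk (Z := Z) ξ
  refine ⟨RingEquiv.ofBijective (algebraMap (Z.presheaf.stalk ξ) Z.functionField).rangeRestrict
    ⟨fun _ _ h => algebraMap_stalk_functionField_injective ξ (congrArg Subtype.val h),
      (algebraMap (Z.presheaf.stalk ξ) Z.functionField).rangeRestrict_surjective⟩, fun _ => rfl, fun a => ?_⟩
  rw [mem_maximalIdeal, mem_maximalIdeal, mem_nonunits_iff, mem_nonunits_iff, MulEquiv.isUnit_map]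

/-! ## The local rings over `ξ` read in the function field -/

/-- `𝒪_{Z,π ξ′} ⊆ ε_{ξ′}(𝒪_{Z′,ξ′})` inside `K(Z)`. [cite: Kollar2007, §1.4] -/
theorem range_algebraMap_stalk_le_fibreSubalgebra [IsLocallyNoetherian Z] (hπ : IsBlowup π J) (ξ' : Z') :
    (algebraMap (Z.presheaf.stalk (π ξ')) Z.functionField).range ≤ (hπ.fibreSubalgebra (π ξ') ξ' rfl).toSubring := by
  rintro _ ⟨b, rfl⟩
  rw [Subalgebra.mem_toSubring, hπ.mem_fibreSubalgebra_iff]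
  exact ⟨(π.stalkMap ξ').hom b, hπ.stalkEmb_stalkMap ξ' b⟩

/-- **`ε_{ξ′}(𝒪_{Z′,ξ′})` dominates `𝒪_{Z,π ξ′}`**: the stalk map of `π` is a local homomorphism. [cite: Cutkosky2014, §2.1] -/
theorem subringDominates_fibreSubalgebra [IsLocallyNoetherian Z] (hπ : IsBlowup π J) (ξ' : Z') :
    SubringDominates (algebraMap (Z.presheaf.stalk (π ξ')) Z.functionField).range
      (hπ.fibreSubalgebra (π ξ') ξ' rfl).toSubring := by
  refine ⟨range_algebraMap_stalk_le_fibreSubalgebra hπ ξ', ?_⟩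
  rintro _ ⟨b, rfl⟩ hinv
  set ι := algebraMap (Z.presheaf.stalk (π ξ')) Z.functionField with hι
  by_cases hb0 : ι b = 0
  · rw [hb0, inv_zero]
    exact ⟨0, map_zero _⟩
  rw [Subalgebra.mem_toSubring, hπ.mem_fibreSubalgebra_iff] at hinv
  obtain ⟨a, ha⟩ := hinv
  -- `π^♯ b · a = 1` in `𝒪_{Z′,ξ′}`
  have h1 : (π.stalkMap ξ').hom b * a = 1 := by
    apply hπ.stalkEmb_injective ξ'
    rw [map_mul, hπ.stalkEmb_stalkMap, ha, map_one, mul_inv_cancel₀ hb0]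
  have hu : IsUnit ((π.stalkMap ξ').hom b) := IsUnit.of_mul_eq_one a h1
  obtain ⟨v, hv⟩ := (isUnit_map_iff (π.stalkMap ξ').hom b).mp hu
  refine ⟨↑v⁻¹, ?_⟩
  rw [← hv]
  exact map_units_inv ι v

/-! ## The ring-theoretic core (port of `ProjModel.isQuadraticTransform_of_chart`, base ring abstract) -/

omit [IsIntegral Z] in
/-- **Core of the dictionary, ring level.** Let `(B, 𝔪)` be a local ring with `𝔪 = (c_1, …, c_k)`, `c_j ≠ 0`, read in a
field `L` by an injective `ι : B → L`; let `ψ : B[𝔪/c_j] → L` (the chart ring `chartRing c j`) extend `ι`, with image inside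
a local subring `R₁ ⊆ L` which dominates `ι(B)` and all of whose elements are fractions `ψ p / ψ q` with `(ψ q)⁻¹ ∈ R₁`.
Then `R₁` is a quadratic transform of `ι(B)`. [cite: Cutkosky2014, §2.1] -/
theorem isQuadraticTransform_of_chart_core {L : Type u} [Field L] {B : Type u} [CommRing B] [IsLocalRing B]
    {k : ℕ} (c : Fin k → B) (j : Fin k) (hc : Ideal.span (Set.range c) = maximalIdeal B) (hcj : c j ≠ 0)
    (ι : B →+* L) (hι : Function.Injective ι) [IsLocalRing ι.range]
    (ψ : chartRing c j →+* L) (hcomp : ∀ b, ψ (chartBase c j b) = ι b)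
    (R₁ : Subring L) (hR₁ : IsLocalRing R₁) (hψmem : ∀ z, ψ z ∈ R₁)
    (hfrac₁ : ∀ z ∈ R₁, ∃ p q : chartRing c j, ψ q ≠ 0 ∧ (ψ q)⁻¹ ∈ R₁ ∧ z = ψ p / ψ q)
    (hdom : SubringDominates ι.range R₁) : IsQuadraticTransform ι.range R₁ := by
  classical
  set R : Subring L := ι.range with hR
  -- `B ≅ R`
  let e : B ≃+* R := RingEquiv.ofBijective ι.rangeRestrict
    ⟨fun _ _ h => hι (congrArg Subtype.val h), ι.rangeRestrict_surjective⟩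
  have hecoe : ∀ b : B, ((e b : R) : L) = ι b := fun b => rfl
  have hemax : ∀ b : B, b ∈ maximalIdeal B ↔ e b ∈ maximalIdeal R := fun b => by
    rw [mem_maximalIdeal, mem_maximalIdeal, mem_nonunits_iff, mem_nonunits_iff, MulEquiv.isUnit_map]
  -- the chart parameter `x₀ = c_j` read in `R`
  let x₀ : R := e (c j)
  have hx₀ : (x₀ : L) = ι (c j) := rfl
  have hx₀0 : (x₀ : L) ≠ 0 := by rw [hx₀]; exact (map_ne_zero_iff _ hι).mpr hcj
  have hcm : ∀ i, c i ∈ maximalIdeal B := fun i => hc ▸ Ideal.subset_span ⟨i, rfl⟩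
  have hx₀m : x₀ ∈ maximalIdeal R := (hemax (c j)).mp (hcm j)
  -- the images of the generators `e_i` of the chart ring: `c_i / c_j`
  have hgen : ∀ i, ψ (chartGen c j i) = ι (c i) / ι (c j) := by
    intro i
    have h := congrArg ψ (reesChartBase_apply_eq_mul_chartGen c j i)
    rw [map_mul] at h
    change ψ (chartBase c j (c i)) = ψ (chartBase c j (c j)) * ψ (chartGen c j i) at h
    rw [hcomp, hcomp] at h
    rw [eq_div_iff (hx₀ ▸ hx₀0), mul_comm, ← h]
  -- (1) `R[𝔪/x₀] ≤ R₁`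
  have hle : R ≤ R₁ := hdom.1
  have hdiv : ∀ i, ι (c i) / ι (c j) ∈ R₁ := fun i => by rw [← hgen]; exact hψmem _
  have hspan : Ideal.span (Set.range fun i => e (c i)) = maximalIdeal R := by
    have h1 : Ideal.span (Set.range fun i => e (c i)) = (Ideal.span (Set.range c)).map e.toRingHom := by
      rw [Ideal.map_span, ← Set.range_comp]; rfl
    rw [h1, hc]
    refine le_antisymm ((Ideal.map_le_iff_le_comap).mpr fun b hb => ?_) fun r hr => ?_
    · rw [Ideal.mem_comap]
      exact (hemax b).mp hb
    · obtain ⟨b, rfl⟩ := e.surjective r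
      exact Ideal.mem_map_of_mem _ ((hemax b).mpr hr)
  have hblow : blowupRing R (x₀ : L) ≤ R₁ := by
    rw [blowupRing_eq_closure_of_span_eq (x₀ : L) _ hspan, Subring.closure_le]
    rintro z (hz | ⟨_, ⟨i, rfl⟩, rfl⟩)
    · exact hle hz
    · exact hdiv i
  -- (2) the chart ring maps into `R[𝔪/x₀]`
  have hchart : ∀ z : chartRing c j, ψ z ∈ blowupRing R (x₀ : L) := by
    intro z
    obtain ⟨m, F, -, hF⟩ := exists_isHomogeneous_eval₂_eq c j z
    rw [← hF]
    change ψ.comp (MvPolynomial.eval₂Hom (chartBase c j) (fun i => chartGen c j i)) F ∈ _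
    rw [MvPolynomial.comp_eval₂Hom]
    let S := blowupRing R (x₀ : L)
    have hcoef : ∀ b, ψ.comp (chartBase c j) b ∈ S := fun b => by
      rw [RingHom.comp_apply, hcomp]; exact le_blowupRing R _ ⟨b, rfl⟩
    have hvar : ∀ i, ψ (chartGen c j i) ∈ S := fun i => by
      rw [hgen, ← hx₀, ← hecoe (c i)]
      exact div_mem_blowupRing (x₀ : L) ((hemax (c i)).mp (hcm i))
    let f : B →+* S := (ψ.comp (chartBase c j)).codRestrict S hcoef
    let v : Fin k → S := fun i => ⟨_, hvar i⟩
    have hf : ψ.comp (chartBase c j) = S.subtype.comp f := rfl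
    have hv : (fun i => ψ (chartGen c j i)) = S.subtype ∘ v := rfl
    rw [hf, hv, MvPolynomial.coe_eval₂Hom, ← MvPolynomial.eval₂_comp_left]
    exact (MvPolynomial.eval₂ f v F).2
  -- (3) fractions with unit denominators
  have hfrac : ∀ z ∈ R₁, ∃ a ∈ blowupRing R (x₀ : L), ∃ b ∈ blowupRing R (x₀ : L), b⁻¹ ∈ R₁ ∧ z = a / b := by
    intro z hz
    obtain ⟨pp, q, -, hqinv, hz⟩ := hfrac₁ z hz
    exact ⟨ψ pp, hchart pp, ψ q, hchart q, hqinv, hz⟩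
  exact ⟨inferInstance, x₀, hx₀m, fun h => hx₀0 (by rw [h]; rfl), hR₁, hblow, hfrac, hdom⟩

/-! ## The scheme-level dictionary -/

set_option maxHeartbeats 800000 in
-- the chart presentation of the stalk of a blowing up elaborates large terms (cf. `BlowupExceptionalGenericOrder.lean`)
/-- **The local rings over the blown-up point are quadratic transforms** (Zariski's dictionary; port of
`ProjModel.isQuadraticTransform_of_chart` to `K(Z)`): for a blowing up `π : Z′ → Z` along `J` with `J_{π ξ′} = 𝔪_{π ξ′}`,
the image `ε_{ξ′}(𝒪_{Z′,ξ′}) ⊆ K(Z)` is a quadratic transform of the image of `𝒪_{Z,π ξ′}`: by the chart presentation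
`𝒪_{Z′,ξ′} = (𝒪_{Z,ξ}[𝔪_ξ/c_j])_𝔴` (Stacks 0804/0805, tree `IsBlowup.exists_reesChart_stalk`) it contains `𝒪_{Z,ξ}[𝔪_ξ/c_j]`,
consists of fractions of it with unit denominators, and dominates `𝒪_{Z,ξ}`. [cite: Cutkosky2014, §2.1] -/
theorem isQuadraticTransform_fibreSubalgebra [IsIntegral Z'] [IsLocallyNoetherian Z] (hπ : IsBlowup π J) (ξ' : Z')
    (hJ : stalkIdeal J (π ξ') = maximalIdeal (Z.presheaf.stalk (π ξ'))) :
    IsQuadraticTransform (algebraMap (Z.presheaf.stalk (π ξ')) Z.functionField).range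
      (hπ.fibreSubalgebra (π ξ') ξ' rfl).toSubring := by
  classical
  haveI hRloc : IsLocalRing (algebraMap (Z.presheaf.stalk (π ξ')) Z.functionField).range :=
    isLocalRing_range_algebraMap_stalk (Z := Z) (π ξ')
  have hR₁loc : IsLocalRing (hπ.fibreSubalgebra (π ξ') ξ' rfl).toSubring :=
    hπ.isLocalRing_fibreSubalgebra (π ξ') ξ' rfl
  have memR₁ : ∀ z, z ∈ (hπ.fibreSubalgebra (π ξ') ξ' rfl).toSubring ↔ ∃ a, hπ.stalkEmb ξ' a = z := fun z => by
    rw [Subalgebra.mem_toSubring, hπ.mem_fibreSubalgebra_iff]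
  -- generators of `𝔪 = J_{π ξ′}` and the chart through `ξ′`
  obtain ⟨k, c, hc⟩ := exists_fin_span_eq_stalkIdeal J (π ξ')
  have hcmax : Ideal.span (Set.range c) = maximalIdeal (Z.presheaf.stalk (π ξ')) := hc.trans hJ
  obtain ⟨j, 𝔴, χ, hχ, hloc, -⟩ := hπ.exists_reesChart_stalk ξ' c hc
  letI := χ.toAlgebra
  haveI : IsLocalization.AtPrime (Z'.presheaf.stalk ξ') 𝔴.asIdeal := hloc
  have hχalg : ∀ b, algebraMap (chartRing c j) (Z'.presheaf.stalk ξ') b = χ b := fun b =>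
    congrFun (congrArg DFunLike.coe (RingHom.algebraMap_toAlgebra χ)) b
  -- `c_j ≠ 0`
  haveI : Nontrivial (chartRing c j) := ⟨⟨0, 1, fun h0 =>
    𝔴.isPrime.ne_top ((Ideal.eq_top_iff_one 𝔴.asIdeal).mpr (h0 ▸ 𝔴.asIdeal.zero_mem))⟩⟩
  have hφcj : chartBase c j (c j) ≠ 0 := nonZeroDivisors.ne_zero (reesChartBase_mem_nonZeroDivisors _ _)
  have hcj : c j ≠ 0 := fun h0 => hφcj ((congrArg (chartBase c j) h0).trans (map_zero _))
  -- the chart ring read in `K(Z)` (an opaque name for `ε_{ξ′} ∘ χ`)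
  obtain ⟨ψ, hψ⟩ : ∃ ψ : chartRing c j →+* Z.functionField,
      ∀ z, ψ z = hπ.stalkEmb ξ' (algebraMap (chartRing c j) (Z'.presheaf.stalk ξ') z) :=
    ⟨(hπ.stalkEmb ξ').comp (algebraMap (chartRing c j) (Z'.presheaf.stalk ξ')), fun _ => rfl⟩
  have hcomp : ∀ b, ψ (chartBase c j b) = algebraMap (Z.presheaf.stalk (π ξ')) Z.functionField b := fun b => by
    rw [hψ, hχalg, hχ, hπ.stalkEmb_stalkMap]
  have hψmem : ∀ z, ψ z ∈ (hπ.fibreSubalgebra (π ξ') ξ' rfl).toSubring := fun z => (memR₁ _).mpr ⟨_, (hψ z).symm⟩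
  -- every element of `R₁` is a fraction of chart elements with unit denominator (`𝒪_{Z′,ξ′} = (B_j)_𝔴`)
  have hfrac₁ : ∀ z ∈ (hπ.fibreSubalgebra (π ξ') ξ' rfl).toSubring, ∃ p q : chartRing c j,
      ψ q ≠ 0 ∧ (ψ q)⁻¹ ∈ (hπ.fibreSubalgebra (π ξ') ξ' rfl).toSubring ∧ z = ψ p / ψ q := by
    intro z hz
    obtain ⟨t, rfl⟩ := (memR₁ z).mp hz
    obtain ⟨⟨pp, q⟩, hpq⟩ := IsLocalization.surj 𝔴.asIdeal.primeCompl t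
    obtain ⟨w, hw⟩ := IsLocalization.map_units (Z'.presheaf.stalk ξ') q
    have hq0 : ψ q ≠ 0 := by
      rw [hψ, ← hw]
      exact ((Units.isUnit w).map (hπ.stalkEmb ξ')).ne_zero
    refine ⟨pp, q, hq0, ?_, ?_⟩
    · refine (memR₁ _).mpr ⟨(↑w⁻¹ : Z'.presheaf.stalk ξ'), ?_⟩
      rw [hψ, ← hw]
      refine eq_inv_of_mul_eq_one_left ?_
      rw [← map_mul, Units.inv_mul, map_one]
    · rw [eq_div_iff hq0, hψ, hψ, ← map_mul]
      have hpq' : t * algebraMap (chartRing c j) (Z'.presheaf.stalk ξ') q =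
          algebraMap (chartRing c j) (Z'.presheaf.stalk ξ') pp := hpq
      rw [hpq']
  exact isQuadraticTransform_of_chart_core c j hcmax hcj _ (algebraMap_stalk_functionField_injective (π ξ'))
    ψ hcomp _ hR₁loc hψmem hfrac₁ (subringDominates_fibreSubalgebra hπ ξ')

/-- The same with the base point named: for `ξ′` over `ξ` (`h : π ξ′ = ξ`) with `J_ξ = 𝔪_ξ`, `ε_{ξ′}(𝒪_{Z′,ξ′})` is a
quadratic transform of `𝒪_{Z,ξ}` read in `K(Z)`. [cite: Cutkosky2014, §2.1] -/
theorem isQuadraticTransform_fibreSubalgebra' [IsIntegral Z'] [IsLocallyNoetherian Z] (hπ : IsBlowup π J) {ξ : Z} {ξ' : Z'}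
    (h : π ξ' = ξ) (hJ : stalkIdeal J ξ = maximalIdeal (Z.presheaf.stalk ξ)) :
    IsQuadraticTransform (algebraMap (Z.presheaf.stalk ξ) Z.functionField).range
      (hπ.fibreSubalgebra ξ ξ' h).toSubring := by
  subst h
  exact isQuadraticTransform_fibreSubalgebra hπ ξ' hJ

end FibreDictionary

end CampaignW46

end Summit.ResolutionOfSingularities.ResolutionOfSingularities.Theorems

end
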